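import Summits.NavierStokesRegularity.FluidComputer.ClayBlowupForcedVorticityCriteria
import Summits.NavierStokesRegularity.FluidComputer.ClayBlowupForcedLeraySupRate
import Summits.NavierStokesRegularity.FluidComputer.DesignedBlowupClayBridge
import HarnessLib

/-!
# THE FORCED E–C ROWS ON THE TOWER INTERFACE: Beale–Kato–Majda, the BKM floor, Constantin–Fefferman,
# and LERAY'S COUNTDOWN AGAINST THE PALASEK CLOCK — for every `Realisation ν R`, with its force

Cell `ns-blowup`, seat `ns-blowup-ecbridge-2` (g9; the E–C endpoint theory seat). LABEL: E–C typing
(KERNEL — no named fact). WHAT THIS IS NOT: not Navier–Stokes evidence — necessary conditions on the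
TYPE `PalasekTowerClayBridge.Realisation ν R` (ecbridge-1's tower interface: a forced classical solution
on `[0, T)` with Clay datum and Clay force, readout times `τ_k ∈ [0, T)` with the Palasek clock
`T − τ_{k+1} ≤ c₃ / A_k`, velocity floors `c₁ Y_k ≤ |u(τ_k, x_k)|` and ceilings `|u(t, x)| ≤ c₂ Y_k` for
`t ≤ τ_k`); `PalasekStep2 R` (the interface is inhabited) is the open conjecture of the route and is NOT
asserted here. Companion memo: `run/shared/lean/pub/ns-blowup/ecbridge2/ECBRIDGE-2-MEMO-8.md`.

## Content

A realisation IS a designed blow-up (`Realisation.toDesignedBlowup`), and its force acts up to the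
blow-up time, so only the FORCED rows of the E–C portrait constrain it. g9 made those rows kernel
(`ClayBlowupForcedVorticityCriteria`, `ClayBlowupForcedLeraySupRate`); here they are read in the
interface's own vocabulary:

* `Realisation.lintegral_vorticity_sup_eq_top` — `∫₀ᵀ ‖curl u(t)‖_{L^∞} dt = ∞` (BKM with the tower's
  force); `Realisation.not_subBKMRate` — no `|curl u(t, x)| ≤ C (T − t)^{−γ}` with `γ < 1`;
  `Realisation.vorticityDirection_incoherent` — Constantin–Fefferman with the tower's force;
* **`Realisation.leray_lifespan_at_readout`** — with a universal `c > 0` and `F = sup|P f| ≥ 0`, at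
  EVERY readout time: `c ν < (c₂ Y_k + (T − τ_k) F)² (T − τ_k)` (Leray's lifespan bound WITH the force,
  fed the CEILING `|u(τ_k, ·)| ≤ c₂ Y_k`);
* **`Realisation.leray_countdown_clock`** — combined with the Palasek clock `T − τ_{k+1} ≤ c₃ / A_k`:
  `c ν < (c₂ Y_{k+1} + c₃ F / A_k)² (c₃ / A_k)` for every `k`, i.e. up to the force correction
  **`ν A_k ≲ c₃ c₂² Y_{k+1}²`** — the pump rate of level `k` may not outrun Leray's countdown started from
  the velocity ceiling of level `k + 1` (RATE-TABLE check: `A_k = N_k^β`, `Y_{k+1} = N_k^{b(β−1)}`,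
  consistent iff `β ≤ 2b(β − 1)`, which `2 < 2b < β` grants; the row is the kernel form of that check).

References: J. T. Beale, T. Kato, A. Majda (1984), Thm. 1 [cite: BealeKatoMajda1984, Theorem 1];
P. Constantin, C. Fefferman (1993) [cite: ConstantinFeffermanIndiana1993, Theorem (§1)]; J. Leray (1934),
(3.16) [cite: Leray1934, (3.16)]; S. Palasek, arXiv:2605.13827 §4 [cite: Palasek2026ElementaryModel, §4];
C. L. Fefferman, (C) [cite: FeffermanClay2006, (C)].
-/

noncomputable section

namespace Summit.NavierStokesRegularity.FluidComputer

open Set MeasureTheory Filter Topology Function Metric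
open scoped ENNReal ContDiff NNReal
open Literature.Analysis.FluidPDE
open Summit.NavierStokesRegularity.NavierStokesRegularity

namespace PalasekTowerClayBridge.Realisation

variable {ν : ℝ} {R : TowerRates} (W : Realisation ν R)

/-! ## §1 The forced vorticity rows on the interface -/

/-- **Beale–Kato–Majda for every tower realisation, WITH its force** (`ν > 0`):
`∫₀ᵀ ‖curl u(t)‖_{L^∞} dt = ∞`. [cite: BealeKatoMajda1984, Theorem 1] -/
theorem lintegral_vorticity_sup_eq_top (hν : 0 < ν) :
    (∫⁻ t in Ioo 0 W.T, ⨆ x, ‖curl (W.u t) x‖ₑ) = ⊤ :=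
  W.toDesignedBlowup.lintegral_vorticity_sup_eq_top_forced hν

/-- **The BKM floor for every tower realisation**: no `|curl u(t, x)| ≤ C (T − t)^{−γ}` with `γ < 1`
on `(0, T) × ℝ³`. [cite: BealeKatoMajda1984, Theorem 1 and Corollary] -/
theorem not_subBKMRate (hν : 0 < ν) {C γ : ℝ} (hC : 0 ≤ C) (hγ : γ < 1)
    (hrate : ∀ t ∈ Ioo 0 W.T, ∀ x, ‖curl (W.u t) x‖ ≤ C * (W.T - t) ^ (-γ)) : False :=
  W.toDesignedBlowup.not_subBKMRate hν hC hγ hrate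

/-- **Constantin–Fefferman for every tower realisation, WITH its force**: for every `Ω, ρ > 0` some
`t < T` and points of `{|ω(t, ·)| > Ω}` violate the `ρ⁻¹`-Lipschitz sine condition on the vorticity
directions. [cite: ConstantinFeffermanIndiana1993, Theorem (§1)] -/
theorem vorticityDirection_incoherent (hν : 0 < ν) {Ω ρ : ℝ} (hΩ : 0 < Ω) (hρ : 0 < ρ) :
    ∃ t ∈ Ico 0 W.T, ∃ x y : EuclideanSpace ℝ (Fin 3),
      Ω < ‖curl (W.u t) x‖ ∧ Ω < ‖curl (W.u t) y‖ ∧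
        ‖x - y‖ / ρ <
          Real.sqrt (1 - inner ℝ (vorticityDirection (curl (W.u t)) x)
            (vorticityDirection (curl (W.u t)) y) ^ 2) :=
  W.toDesignedBlowup.vorticityDirection_incoherent_forced hν hΩ hρ

/-! ## §2 Leray's countdown against the Palasek clock -/

/-- The ceiling constant dominates the floor constant: `c₁ Y_k ≤ |u(τ_k, x_k)| ≤ c₂ Y_k` with
`Y_k > 0`, so `0 < c₁ ≤ c₂` and `0 < c₂ Y_k`. [cite: Palasek2026ElementaryModel, §4] -/
theorem c₂_mul_Y_pos (k : ℕ) : 0 < W.c₂ * R.Y k := by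
  obtain ⟨x, -, hfloor⟩ := W.floor k
  have hY : 0 < R.Y k := Real.rpow_pos_of_pos (R.N_pos k) _
  have hceil := W.ceiling k (W.τ k) ⟨(W.τ_mem k).1, le_rfl⟩ x
  have h1 : 0 < W.c₁ * R.Y k := mul_pos W.c₁_pos hY
  linarith

/-- **LERAY'S LIFESPAN BOUND AT EVERY READOUT TIME, WITH THE TOWER'S FORCE** (`ν > 0`; no named
fact): there are a universal `c > 0` and `F ≥ 0` (the sup of the Leray projection of the tower's force)
with `c ν < (c₂ Y_k + (T − τ_k) F)² (T − τ_k)` for every level `k` — `ClayBlowup.forced_leray_lifespan`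
at `t₀ = τ_k` with the CEILING `|u(τ_k, ·)| ≤ c₂ Y_k` as the sup bound. [cite: Leray1934, (3.16)]
[cite: Palasek2026ElementaryModel, §4] -/
theorem leray_lifespan_at_readout (hν : 0 < ν) :
    ∃ c : ℝ, 0 < c ∧ ∃ F : ℝ, 0 ≤ F ∧ ∀ k : ℕ,
      c * ν < (W.c₂ * R.Y k + (W.T - W.τ k) * F) ^ 2 * (W.T - W.τ k) := by
  obtain ⟨c, hc, F, hF0, hlife⟩ := W.toDesignedBlowup.toClayBlowup.forced_leray_lifespan hν
  refine ⟨c, hc, F, hF0, fun k => ?_⟩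
  exact hlife (W.τ k) (W.τ_mem k) (W.c₂ * R.Y k) (W.c₂_mul_Y_pos k)
    fun x => W.ceiling k (W.τ k) ⟨(W.τ_mem k).1, le_rfl⟩ x

/-- **LERAY'S COUNTDOWN AGAINST THE PALASEK CLOCK** (`ν > 0`; no named fact): with the `c, F` of
`leray_lifespan_at_readout`, for every level `k`:
`c ν < (c₂ Y_{k+1} + c₃ F / A_k)² (c₃ / A_k)` — the clock `T − τ_{k+1} ≤ c₃ / A_k` substituted into the
lifespan bound at the readout of level `k + 1` (the right-hand side is monotone in `T − τ_{k+1}`). Up to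
the force correction `c₃ F / A_k → 0`: `ν A_k < c₃ c₂² Y_{k+1}² / c`, the level-`k` pump rate may not
outrun Leray's countdown from the level-`(k+1)` velocity ceiling. [cite: Leray1934, (3.16)]
[cite: Palasek2026ElementaryModel, §4] -/
theorem leray_countdown_clock (hν : 0 < ν) :
    ∃ c : ℝ, 0 < c ∧ ∃ F : ℝ, 0 ≤ F ∧ ∀ k : ℕ,
      c * ν < (W.c₂ * R.Y (k + 1) + W.c₃ / R.A k * F) ^ 2 * (W.c₃ / R.A k) := by
  obtain ⟨c, hc, F, hF0, hlife⟩ := W.leray_lifespan_at_readout hν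
  refine ⟨c, hc, F, hF0, fun k => ?_⟩
  have h := hlife (k + 1)
  have hD0 : 0 < W.T - W.τ (k + 1) := by linarith [(W.τ_mem (k + 1)).2]
  have hclock : W.T - W.τ (k + 1) ≤ W.c₃ / R.A k := W.clock k
  have hK0 : 0 < W.c₂ * R.Y (k + 1) := W.c₂_mul_Y_pos (k + 1)
  have hmono1 : W.c₂ * R.Y (k + 1) + (W.T - W.τ (k + 1)) * F ≤
      W.c₂ * R.Y (k + 1) + W.c₃ / R.A k * F := by
    have := mul_le_mul_of_nonneg_right hclock hF0
    linarith
  have hK1 : 0 ≤ W.c₂ * R.Y (k + 1) + (W.T - W.τ (k + 1)) * F := by positivity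
  calc c * ν < (W.c₂ * R.Y (k + 1) + (W.T - W.τ (k + 1)) * F) ^ 2 * (W.T - W.τ (k + 1)) := h
    _ ≤ (W.c₂ * R.Y (k + 1) + W.c₃ / R.A k * F) ^ 2 * (W.T - W.τ (k + 1)) :=
        mul_le_mul_of_nonneg_right (pow_le_pow_left₀ hK1 hmono1 2) hD0.le
    _ ≤ (W.c₂ * R.Y (k + 1) + W.c₃ / R.A k * F) ^ 2 * (W.c₃ / R.A k) :=
        mul_le_mul_of_nonneg_left hclock (sq_nonneg _)

/-- **The countdown in rate form**: `c ν A_k < c₃ (c₂ Y_{k+1} + c₃ F / A_k)²` for every `k`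
(`A_k > 0`). [cite: Leray1934, (3.16)] [cite: Palasek2026ElementaryModel, §4] -/
theorem leray_countdown_rate (hν : 0 < ν) :
    ∃ c : ℝ, 0 < c ∧ ∃ F : ℝ, 0 ≤ F ∧ ∀ k : ℕ,
      c * ν * R.A k < W.c₃ * (W.c₂ * R.Y (k + 1) + W.c₃ / R.A k * F) ^ 2 := by
  obtain ⟨c, hc, F, hF0, hclock⟩ := W.leray_countdown_clock hν
  refine ⟨c, hc, F, hF0, fun k => ?_⟩
  have hA := R.A_pos k
  have h := hclock k
  have h' : c * ν * R.A k < (W.c₂ * R.Y (k + 1) + W.c₃ / R.A k * F) ^ 2 * (W.c₃ / R.A k) * R.A k :=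
    mul_lt_mul_of_pos_right h hA
  calc c * ν * R.A k < (W.c₂ * R.Y (k + 1) + W.c₃ / R.A k * F) ^ 2 * (W.c₃ / R.A k) * R.A k := h'
    _ = W.c₃ * (W.c₂ * R.Y (k + 1) + W.c₃ / R.A k * F) ^ 2 := by
        field_simp

end PalasekTowerClayBridge.Realisation

/-! ## §3 The open statement's price in these rows -/

/-- **What Palasek's Step 2 must pay, vorticity and countdown form** (no named fact; `PalasekStep2 R`
is NOT asserted): if the interface is inhabited at some `ν > 0`, the realisation has non-integrable
vorticity maximum up to `T` and its rates pass Leray's countdown `c ν A_k < c₃ (c₂ Y_{k+1} + c₃F/A_k)²`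
at every level. [cite: Palasek2026ElementaryModel, §4] [cite: Leray1934, (3.16)] -/
theorem realisation_price_vorticity_countdown {ν : ℝ} (hν : 0 < ν) {R : PalasekTowerClayBridge.TowerRates}
    (W : PalasekTowerClayBridge.Realisation ν R) :
    (∫⁻ t in Ioo 0 W.T, ⨆ x, ‖curl (W.u t) x‖ₑ) = ⊤ ∧
      ∃ c : ℝ, 0 < c ∧ ∃ F : ℝ, 0 ≤ F ∧ ∀ k : ℕ,
        c * ν * R.A k < W.c₃ * (W.c₂ * R.Y (k + 1) + W.c₃ / R.A k * F) ^ 2 :=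
  ⟨W.lintegral_vorticity_sup_eq_top hν, W.leray_countdown_rate hν⟩

end Summit.NavierStokesRegularity.FluidComputer

end
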